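import Summits.QuantumFields.YangMills.Theorems.BalabanUVNodesN15CurvedPerturbationLettersUN
import Summits.QuantumFields.YangMills.Theorems.BalabanUVNodesN15SmallFieldAxialGaugeUN
import Literature.MathematicalPhysics.QuantumFieldTheory.Balaban1983to89.T4SmallFieldWindowSandwich
import HarnessLib

/-!
# Route «BalabanUVNodes» (cluster K4 «SpineRates»), Track-A DAG node N15 = NE2, BACKGROUND LAYER — END TO END AT GROUP LEVEL: a PLAQUETTE-SMALL `U(N)` configuration on a
# non-wrapping box gives, in the axial gauge, dag-n15-w3 file 1's ENTRYWISE TRANSPORTER LETTER `|S(b) − 1|_{ij} ≤ κ_e·2|n|·(d − 1)·N·δ` for `S(b) = coordMat e (Ad_{U^u(b)})` on every box bond,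
# with `S(b)` orthogonal on both sides — the first inequality of (3.35) delivered in the curved species' own currency, no chart, no logarithm

Cell `pub-ymgap`, seat `pub-ymgap-dag-n15-w2` (WIDTH SEAT 2∕3 on node N15, director-ym №197 ∕ HUMAN RULING D-0149), g5, fourth piece (bus CLAIM-4) — the knit of this seat's g5 FILE 2
`…CurvedPerturbationLettersUN` (group-level letters for `coordMat e (Ad_U)`) with g5 FILE 3 `…SmallFieldAxialGaugeUN` (the `U(N)` axial-gauge junction in the Frobenius currency).
`bears_on: R4∕N15 · K3⁸ SpineGivenEndpointR13SepCoPHV (stmt-QuantumFields-27366)`.  Filed `--kind proof --supports stmt-QuantumFields-27366 --as helper` — COUNT-NEUTRAL.  Theorems only;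
0 `def`, 0 `sorry`.  Imports BY NAME the two files just named (`uN_abs_coordMat_conj_sub_entry_le`, `coordMat_conj_one`; `uN_frobenius_norm_sub_one_le_of_dist1`,
`uN_coe_conjTranspose_mul_self`, `uN_frobenius_gaugeAct_axialGauge_le_of_mem_boxBonds`), g2 `uN_coordMat_conj_orthogonal` (through FILE 2's closure), pub-balaban `T4AxialGaugeSmallField`
(`axialGauge`, `boxBonds`, `boxPlaqs`), `T4SmallFieldWindowSandwich` (`plaqSmallOn_one`) and `UnitaryModel` (`instGaugeGroupUnitaryGroup`); nothing in the tree is modified, no landed name re-declared.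

WHY.  The curved species of dag-n15-w3 file 1 (`…CurvedLaplacianSpecies`) displays its perturbation through ONE entrywise letter per bond, `|(S − 1)_{ij}| ≤ ηp₀` (`hSp`), on an
ORTHOGONAL transporter `S` (`hS`); FILE 2 reads `hSp` off `‖U − 1‖_F` for `S = coordMat e (Ad_U)`, FILE 3 reads `‖U^u(b) − 1‖_F` off plaquette smallness through the axial gauge.  THIS FILE
composes them, bond by bond:
* §1 ★ `uN_transporterLetter_of_dist1` — for `W ∈ U(n)`: `|(coordMat e (Ad_W) − 1)_{ij}| ≤ κ_e·(2|n|)·dist1 W` (`2√|n|·√|n| = 2|n|`), and ★ `uN_transporter_orthogonal` (`SSᵀ = SᵀS = 1`,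
  g2) — the interface distance ALONE controls file 1's letter;
* §2 ★★★ `uN_transporterLetter_gaugeAct_axialGauge_of_mem_boxBonds` — plaquettes `< δ` on the plaquettes of a non-wrapping box of `N + 1` sites per direction ⟹ on every box bond `b`
  the axial-gauge transporter `S(b) = coordMat e (Ad_{U^u(b)})` satisfies `|(S(b) − 1)_{ij}| ≤ κ_e·(2|n|)·((d − 1)·N·δ)`; ★★ `uN_exists_gauge_transporterLetter_of_plaqSmallOn` (∃-form
  with orthogonality ∧ letter on all box bonds) — file 1's `hS` ∧ `hSp` (with `ηp₀ := κ_e·2|n|·(d − 1)Nδ`) for the bond variables of a GENUINE small-field `U(N)` configuration;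
* §3 (A6, NON-VACUITY) `uN_exists_gauge_transporterLetter_one` — the hypothesis set is INHABITED: the flat configuration is plaquette-small for every `δ > 0` (pub-balaban
  `T4SmallFieldWindowSandwich.plaqSmallOn_one` BY NAME), so the junction fires there.

HONEST FRAMING ∕ LIMITS.  Junction bookkeeping; only the FIRST inequality of (3.35) p. 396 (the sup letter `hSp`); file 1's SECOND letter `hSq` (covariant backward difference,
print's `|∇^η_U A|`) is NOT produced (needs the smooth Sect.-F gauge); box only, non-wrapping; constants crude (`(d − 1)N`, `2|n|`); `PlaqSmallOn` strict, conclusions `≤`; group level.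
Nothing of [B5]∕[B6]∕[B9]∕[Balaban1985Averaging] asserted beyond cited shapes; NE2⁺ NOT PRINTED ∕ NOT proved; N15 NOT discharged; K3⁸ OPEN, skeleton v6 untouched; counts of record UNMOVED
(typed 28∕28 · discharged 5∕27 · A 5∕28); one finite 𝕋⁴ at fixed ε — NOT ℝ⁴ ∕ OS ∕ mass gap ∕ Clay; R4 closes the conditional finite-𝕋⁴ rung `BalabanLadder.UV` only.  Restate-immune.
-/

set_option autoImplicit false

noncomputable section
open scoped BigOperators Matrix Matrix.Norms.Frobenius

namespace Summit.QuantumFields.YangMills.BalabanUVNodes.N15.CurvedSpecies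

open Literature.MathematicalPhysics.QuantumFieldTheory.Balaban1983to89
open Literature.MathematicalPhysics.QuantumFieldTheory.Balaban1983to89.T4AxialGaugeSmallField
open Literature.MathematicalPhysics.QuantumFieldTheory.Balaban1983to89.T4SmallFieldWindowSandwich (plaqSmallOn_one)
open Summit.QuantumFields.YangMills.BalabanUVNodes.N15.MatrixSpecies (coordMat basisConst basisConst_nonneg)
open Literature.Barriers.QuantumFields (traceForm)

variable {n : Type} [Fintype n] [DecidableEq n] [Nonempty n] {κ : Type} [Fintype κ] [DecidableEq κ] (e : Matrix n n ℂ ≃L[ℝ] (κ → ℝ))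

/-! ## §1 The interface distance alone controls file 1's entrywise transporter letter -/

/-- ★ **`dist1` CONTROLS THE TRANSPORTER LETTER**: for `W ∈ U(n)`, `|(coordMat e (Ad_W) − 1)_{ij}| ≤ κ_e·(2|n|)·dist1 W` (FILE 2 `uN_abs_coordMat_conj_sub_entry_le` at `(W, 1)` + FILE 3
`uN_frobenius_norm_sub_one_le_of_dist1`; `2√|n|·√|n| = 2|n|`). [cite: Balaban1985BackgroundPropagators, (3.35)∕(3.37) p.396 (shape); Balaban1985Averaging, (19) p.21] -/
theorem uN_transporterLetter_of_dist1 (W : Matrix.unitaryGroup n ℂ) (i j : κ) :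
    |(coordMat e (ContinuousLinearMap.mulLeftRight ℝ (Matrix n n ℂ) (W : Matrix n n ℂ) (W : Matrix n n ℂ)ᴴ) - 1) i j| ≤
      basisConst e * (2 * Fintype.card n) * dist1 W := by
  have h1 : (1 : Matrix n n ℂ)ᴴ * 1 = 1 := by rw [Matrix.conjTranspose_one, Matrix.mul_one]
  have hn : Real.sqrt (Fintype.card n) * Real.sqrt (Fintype.card n) = Fintype.card n := Real.mul_self_sqrt (Nat.cast_nonneg _)
  rw [← coordMat_conj_one e]
  calc _ ≤ basisConst e * (2 * Real.sqrt (Fintype.card n) * ‖(W : Matrix n n ℂ) - 1‖) := uN_abs_coordMat_conj_sub_entry_le e h1 (uN_coe_conjTranspose_mul_self W) i j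
    _ ≤ basisConst e * (2 * Real.sqrt (Fintype.card n) * (Real.sqrt (Fintype.card n) * dist1 W)) := by
        gcongr; exacts [basisConst_nonneg e, uN_frobenius_norm_sub_one_le_of_dist1 W]
    _ = basisConst e * (2 * (Real.sqrt (Fintype.card n) * Real.sqrt (Fintype.card n))) * dist1 W := by ring
    _ = basisConst e * (2 * Fintype.card n) * dist1 W := by rw [hn]

omit [Nonempty n] in
/-- ★ **THE TRANSPORTER OF A `U(n)` BOND VARIABLE IS ORTHOGONAL ON BOTH SIDES** in trace-form-orthonormal coordinates (g2 `uN_coordMat_conj_orthogonal`) — file 1's `hS` and its transpose twin.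
[cite: Balaban1985BackgroundPropagators, (3.50) p.400 (shape)] -/
theorem uN_transporter_orthogonal (he : ∀ A B : Matrix n n ℂ, traceForm A B = e A ⬝ᵥ e B) (W : Matrix.unitaryGroup n ℂ) :
    coordMat e (ContinuousLinearMap.mulLeftRight ℝ (Matrix n n ℂ) (W : Matrix n n ℂ) (W : Matrix n n ℂ)ᴴ) *
          (coordMat e (ContinuousLinearMap.mulLeftRight ℝ (Matrix n n ℂ) (W : Matrix n n ℂ) (W : Matrix n n ℂ)ᴴ))ᵀ = 1 ∧
      (coordMat e (ContinuousLinearMap.mulLeftRight ℝ (Matrix n n ℂ) (W : Matrix n n ℂ) (W : Matrix n n ℂ)ᴴ))ᵀ *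
          coordMat e (ContinuousLinearMap.mulLeftRight ℝ (Matrix n n ℂ) (W : Matrix n n ℂ) (W : Matrix n n ℂ)ᴴ) = 1 :=
  ⟨(uN_coordMat_conj_orthogonal e he (uN_coe_conjTranspose_mul_self W)).2, (uN_coordMat_conj_orthogonal e he (uN_coe_conjTranspose_mul_self W)).1⟩

/-! ## §2 Plaquette-small on a box ⟹ file 1's `hS` ∧ `hSp` for the axial-gauge bond variables -/

variable {P : Params} {j : ℕ}

/-- ★★★ **PLAQUETTE-SMALL ⟹ THE TRANSPORTER LETTER ON EVERY BOX BOND, AXIAL GAUGE, `G = U(N)`**: plaquettes `< δ` (operator norm) on the plaquettes of a non-wrapping box `[lo, hi]` of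
`N + 1` sites per direction (`S₀ ⊇ boxPlaqs lo hi`, `hi ≤ lo + N`, `N < sitesPerDir j`, `0 ≤ δ`) ⟹ for every box bond `b`, `S(b) = coordMat e (Ad_{U^u(b)})`, `u = axialGauge U lo hi`:
`|(S(b) − 1)_{ij}| ≤ κ_e·(2|n|)·((d − 1)·N·δ)` — file 1's `hSp` with `ηp₀ := κ_e·2|n|·(d − 1)Nδ`. [cite: Balaban1985BackgroundPropagators, (3.35) p.396 (first inequality: shape); Balaban1985Averaging, (19) p.21] -/
theorem uN_transporterLetter_gaugeAct_axialGauge_of_mem_boxBonds (U : GaugeField P j (Matrix.unitaryGroup n ℂ)) {lo hi : Fin P.d → ℤ} {δ : ℝ} {S₀ : Set (Plaq P j)} {N : ℕ}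
    (hS₀ : boxPlaqs lo hi ⊆ S₀) (hU : PlaqSmallOn S₀ δ U) (hδ : 0 ≤ δ) (hn : ∀ k, hi k ≤ lo k + N) (hnN : N < P.sitesPerDir j) {b : PBond P j} (hb : b ∈ boxBonds lo hi) (i i' : κ) :
    |(coordMat e (ContinuousLinearMap.mulLeftRight ℝ (Matrix n n ℂ) ((GaugeField.gaugeAct (axialGauge U lo hi) U b : Matrix.unitaryGroup n ℂ) : Matrix n n ℂ)
        ((GaugeField.gaugeAct (axialGauge U lo hi) U b : Matrix.unitaryGroup n ℂ) : Matrix n n ℂ)ᴴ) - 1) i i'| ≤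
      basisConst e * (2 * Fintype.card n) * (((P.d - 1 : ℕ) : ℝ) * N * δ) :=
  (uN_transporterLetter_of_dist1 e _ i i').trans
    (mul_le_mul_of_nonneg_left (dist1_gaugeAct_axialGauge_le_of_mem_boxBonds U hS₀ hU hδ hn hnN hb) (mul_nonneg (basisConst_nonneg e) (by positivity)))

/-- ★★ **∃-FORM — file 1's `hS` ∧ `hSp` FOR A GENUINE SMALL-FIELD `U(N)` CONFIGURATION ON A BOX**: under the same hypotheses there is a gauge transformation `u` such that on every box
bond the transporter `S(b) = coordMat e (Ad_{U^u(b)})` is orthogonal on both sides AND `|(S(b) − 1)_{ij}| ≤ κ_e·(2|n|)·((d − 1)·N·δ)` for all `i, j`.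
[cite: Balaban1985BackgroundPropagators, (3.35) p.396 (shape), (3.50) p.400; Balaban1985Averaging, (19) p.21] -/
theorem uN_exists_gauge_transporterLetter_of_plaqSmallOn (he : ∀ A B : Matrix n n ℂ, traceForm A B = e A ⬝ᵥ e B) (U : GaugeField P j (Matrix.unitaryGroup n ℂ))
    {lo hi : Fin P.d → ℤ} {δ : ℝ} {S₀ : Set (Plaq P j)} {N : ℕ} (hS₀ : boxPlaqs lo hi ⊆ S₀) (hU : PlaqSmallOn S₀ δ U) (hδ : 0 ≤ δ) (hn : ∀ k, hi k ≤ lo k + N)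
    (hnN : N < P.sitesPerDir j) :
    ∃ u : GaugeTransf P j (Matrix.unitaryGroup n ℂ), ∀ b ∈ boxBonds lo hi,
      coordMat e (ContinuousLinearMap.mulLeftRight ℝ (Matrix n n ℂ) ((GaugeField.gaugeAct u U b : Matrix.unitaryGroup n ℂ) : Matrix n n ℂ)
            ((GaugeField.gaugeAct u U b : Matrix.unitaryGroup n ℂ) : Matrix n n ℂ)ᴴ) *
          (coordMat e (ContinuousLinearMap.mulLeftRight ℝ (Matrix n n ℂ) ((GaugeField.gaugeAct u U b : Matrix.unitaryGroup n ℂ) : Matrix n n ℂ)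
            ((GaugeField.gaugeAct u U b : Matrix.unitaryGroup n ℂ) : Matrix n n ℂ)ᴴ))ᵀ = 1 ∧
        (coordMat e (ContinuousLinearMap.mulLeftRight ℝ (Matrix n n ℂ) ((GaugeField.gaugeAct u U b : Matrix.unitaryGroup n ℂ) : Matrix n n ℂ)
            ((GaugeField.gaugeAct u U b : Matrix.unitaryGroup n ℂ) : Matrix n n ℂ)ᴴ))ᵀ *
          coordMat e (ContinuousLinearMap.mulLeftRight ℝ (Matrix n n ℂ) ((GaugeField.gaugeAct u U b : Matrix.unitaryGroup n ℂ) : Matrix n n ℂ)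
            ((GaugeField.gaugeAct u U b : Matrix.unitaryGroup n ℂ) : Matrix n n ℂ)ᴴ) = 1 ∧
        ∀ i i' : κ, (|(coordMat e (ContinuousLinearMap.mulLeftRight ℝ (Matrix n n ℂ) ((GaugeField.gaugeAct u U b : Matrix.unitaryGroup n ℂ) : Matrix n n ℂ)
            ((GaugeField.gaugeAct u U b : Matrix.unitaryGroup n ℂ) : Matrix n n ℂ)ᴴ) - 1) i i'| ≤ basisConst e * (2 * Fintype.card n) * (((P.d - 1 : ℕ) : ℝ) * N * δ)) :=
  ⟨axialGauge U lo hi, fun _ hb => ⟨(uN_transporter_orthogonal e he _).1, (uN_transporter_orthogonal e he _).2,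
    fun i i' => uN_transporterLetter_gaugeAct_axialGauge_of_mem_boxBonds e U hS₀ hU hδ hn hnN hb i i'⟩⟩

/-! ## §3 A6: the hypothesis set is inhabited (the flat configuration) -/

/-- **NON-VACUITY (A6)**: the flat configuration `U ≡ 1` is plaquette-small on any plaquette set for every `δ > 0` (pub-balaban `plaqSmallOn_one`), so on every non-wrapping box of `N + 1`
sites per direction the junction `uN_exists_gauge_transporterLetter_of_plaqSmallOn` FIRES: its hypotheses are inhabited (and the conclusion there is the trivial one, as it must be).
[folklore] -/
theorem uN_exists_gauge_transporterLetter_one (he : ∀ A B : Matrix n n ℂ, traceForm A B = e A ⬝ᵥ e B) {lo hi : Fin P.d → ℤ} {δ : ℝ} (hδ : 0 < δ) {N : ℕ}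
    (hn : ∀ k, hi k ≤ lo k + N) (hnN : N < P.sitesPerDir j) :
    ∃ u : GaugeTransf P j (Matrix.unitaryGroup n ℂ), ∀ b ∈ boxBonds lo hi,
      coordMat e (ContinuousLinearMap.mulLeftRight ℝ (Matrix n n ℂ) ((GaugeField.gaugeAct u (1 : GaugeField P j (Matrix.unitaryGroup n ℂ)) b : Matrix.unitaryGroup n ℂ) : Matrix n n ℂ)
            ((GaugeField.gaugeAct u (1 : GaugeField P j (Matrix.unitaryGroup n ℂ)) b : Matrix.unitaryGroup n ℂ) : Matrix n n ℂ)ᴴ) *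
          (coordMat e (ContinuousLinearMap.mulLeftRight ℝ (Matrix n n ℂ) ((GaugeField.gaugeAct u (1 : GaugeField P j (Matrix.unitaryGroup n ℂ)) b : Matrix.unitaryGroup n ℂ) : Matrix n n ℂ)
            ((GaugeField.gaugeAct u (1 : GaugeField P j (Matrix.unitaryGroup n ℂ)) b : Matrix.unitaryGroup n ℂ) : Matrix n n ℂ)ᴴ))ᵀ = 1 ∧
        (coordMat e (ContinuousLinearMap.mulLeftRight ℝ (Matrix n n ℂ) ((GaugeField.gaugeAct u (1 : GaugeField P j (Matrix.unitaryGroup n ℂ)) b : Matrix.unitaryGroup n ℂ) : Matrix n n ℂ)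
            ((GaugeField.gaugeAct u (1 : GaugeField P j (Matrix.unitaryGroup n ℂ)) b : Matrix.unitaryGroup n ℂ) : Matrix n n ℂ)ᴴ))ᵀ *
          coordMat e (ContinuousLinearMap.mulLeftRight ℝ (Matrix n n ℂ) ((GaugeField.gaugeAct u (1 : GaugeField P j (Matrix.unitaryGroup n ℂ)) b : Matrix.unitaryGroup n ℂ) : Matrix n n ℂ)
            ((GaugeField.gaugeAct u (1 : GaugeField P j (Matrix.unitaryGroup n ℂ)) b : Matrix.unitaryGroup n ℂ) : Matrix n n ℂ)ᴴ) = 1 ∧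
        ∀ i i' : κ, (|(coordMat e (ContinuousLinearMap.mulLeftRight ℝ (Matrix n n ℂ) ((GaugeField.gaugeAct u (1 : GaugeField P j (Matrix.unitaryGroup n ℂ)) b : Matrix.unitaryGroup n ℂ) : Matrix n n ℂ)
            ((GaugeField.gaugeAct u (1 : GaugeField P j (Matrix.unitaryGroup n ℂ)) b : Matrix.unitaryGroup n ℂ) : Matrix n n ℂ)ᴴ) - 1) i i'| ≤
          basisConst e * (2 * Fintype.card n) * (((P.d - 1 : ℕ) : ℝ) * N * δ)) :=
  uN_exists_gauge_transporterLetter_of_plaqSmallOn e he 1 (S₀ := boxPlaqs lo hi) subset_rfl (plaqSmallOn_one _ hδ) hδ.le hn hnN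

end Summit.QuantumFields.YangMills.BalabanUVNodes.N15.CurvedSpecies

end
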